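import Summits.MatrixMultiplication.OmegaCensus.STPPSmallPatternWitnesses

/-!
# ω-census, small pattern `(2,1,1)¹²`: the non-cyclic order-98 host `ℤ/7 × ℤ/7 × ℤ/2` (kernel witness)

Cell `pub-omega`, ω construction census, seat pub-omega ENG2 (gen 36). HONEST FRAMING (verbatim): lottery ticket; floor =
certified bounds/negative ranges.  Census STRUCTURE bookkeeping (row B5, column `T1` at `k = 12`; conjecture C10 (c″)); nothing here bears on `ω`.

The `k = 12` T1 order law of this seat is filed at threshold `99` (`STPPSmallPatternT1K12OrderLaw.lean`) and the cyclic ray is gap-free from `96`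
(`exists_isSTPP_211pow12_zmod_of_le96`).  Between them: `97` is prime (cyclic), `98 = 2·7²` has exactly one non-cyclic abelian type, `ℤ/7 × ℤ/7 × ℤ/2`,
for which engine γ (capped random-`C`, desk; 49th `C` under cap `4·10⁷` after ≈ 250 blank samples at cap `10⁷`; def51 PASS) found the family below ⇒
with the law and the ray, EVERY finite abelian group of order `97` or `98` hosts `(2,1,1)¹²` (type by type; no law is claimed in this file).  At order
`96` only `ℤ/96` is known to host: the six non-cyclic types (`ℤ/16×ℤ/3×ℤ/2`, `ℤ/8×ℤ/4×ℤ/3`, `ℤ/8×ℤ/3×ℤ/2×ℤ/2`, `ℤ/4×ℤ/4×ℤ/3×ℤ/2`, `ℤ/4×ℤ/3×(ℤ/2)³`,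
`ℤ/3×(ℤ/2)⁵`, all of exponent `≤ 48`) gave no family in ≈ 330 capped samples each at three caps — NO word on them.
References: H. Cohn, R. Kleinberg, B. Szegedy, C. Umans, FOCS 2005 (arXiv:math/0511460), Def. 5.1.  Seat pub-omega ENG2 (gen 36), 2026-08-29;
records HOME `pub-omega-eng2-g36/results/sweep9/blanks12/`.
-/

open Literature.Computability.AlgebraicComplexity Finset

namespace Summit.MatrixMultiplication.OmegaCensus

/-- **`(2,1,1)¹² ⊆ ℤ/7 × ℤ/7 × ℤ/2`** (order `98`, exponent `14`; the only non-cyclic abelian group of order `98`). [cite: CohnKleinbergSzegedyUmans2005, Def. 5.1] -/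
theorem exists_isSTPP_211pow12_seed_7_7_2 :
    ∃ A B C : Fin 12 → Finset (ZMod 7 × ZMod 7 × ZMod 2), IsSTPP A B C ∧ ∀ i, (A i).card = 2 ∧ (B i).card = 1 ∧ (C i).card = 1 :=
  exists_isSTPP_of_lists_cards (H := ZMod 7 × ZMod 7 × ZMod 2)
    ![[(0, 0, 0), (0, 2, 1)], [(0, 1, 0), (5, 0, 0)], [(1, 6, 0), (2, 2, 0)], [(2, 4, 1), (1, 0, 1)], [(3, 0, 1), (2, 0, 0)], [(6, 0, 1), (1, 1, 1)], [(1, 4, 0), (3, 2, 0)], [(4, 6, 1), (0, 6, 0)], [(1, 0, 0), (2, 4, 0)], [(5, 1, 0), (6, 1, 1)], [(2, 5, 0), (5, 5, 1)], [(1, 5, 0), (4, 6, 0)]]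
    ![[(0, 0, 0)], [(0, 1, 1)], [(0, 3, 0)], [(2, 1, 0)], [(3, 6, 0)], [(4, 0, 0)], [(4, 0, 1)], [(4, 2, 0)], [(5, 2, 1)], [(5, 6, 0)], [(6, 2, 0)], [(6, 3, 1)]]
    ![[(0, 0, 0)], [(0, 0, 0)], [(0, 0, 0)], [(0, 0, 0)], [(0, 0, 0)], [(0, 0, 0)], [(0, 0, 0)], [(0, 0, 0)], [(0, 0, 0)], [(0, 0, 0)], [(0, 0, 0)], [(0, 0, 0)]]
    (by decide +kernel) (by decide +kernel)

end Summit.MatrixMultiplication.OmegaCensus
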